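import Summits.ValiantsHypothesis.ValiantsHypothesis.Theorems.MonotoneRestorationOrbitRestorationQPValueOrbitClosure
import Summits.ValiantsHypothesis.ValiantsHypothesis.Theorems.MonotoneRestorationMonotoneRestorationQPZetaPatterns
import Literature.Computability.AlgebraicComplexity.PatternExpressions
import HarnessLib

/-!
# Route MonotoneRestoration — aside `OrbitCompressionQP` (stmt-ValiantsHypothesis-18332), line
# `expression_compression`: NARROW EXPRESSIONS HAVE QUASI-POLYNOMIAL ORBITS (the converse of Stub 1)

Line `Cruxes/OrbitCompressionQP/Lines/expression_compression.lean` cuts the aside at "narrow closed pattern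
expressions of unbounded length" (`stub_orbitToNarrowExpression`: qp-ORBIT square-symmetric circuits ⇒
`f n = e.close n` with `n^{k+l} ≤ 2^{(log₂ n + c)^c}` labels; `stub_narrowExpressionCompression`: compress the
LENGTH using `VP`).  This file proves, unconditionally and for expressions of ANY length, the CONVERSE of the
first stub:

* `exists_valueDerivation_value` / `exists_valueDerivation_close` — the values `value n e ρ γ` of a labelled
  pattern expression with `k` row and `l` column labels, and its closed polynomial, form a VALUE DERIVATION
  (`Theorems.ValueDerivation`: an ordinary straight-line computation, weighted sums of any fan-in and binary
  products) every value of which is fixed by the pointwise stabiliser of at most `k + l` indices (its labels);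
* `exists_symmetric_orbit_le_of_close` — hence (value-orbit symmetrisation through rigid supports,
  `ValueOrbit.qpOrbit_of_supportedDerivation`) `e.close n` has a square-symmetric circuit of ORBIT size
  `≤ (n+1)^{2(k+l)+4}` — whatever the length of `e`;
* `qpOrbit_of_narrowExpression` — **the conclusion of `stub_orbitToNarrowExpression` implies its circuit
  hypothesis**: a family presented by narrow closed expressions (polylog labels, any length) has
  square-symmetric circuits of quasi-polynomial orbit size.  So the REPAIRED first stub (with the matrix
  symmetry of `f` added — the registered form is refuted, `OrbitToNarrowExpression.not_stub_orbitToNarrowExpression`)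
  would make "narrow expressions" and "qp orbits" EQUIVALENT presentations of a matrix-symmetric family
  (sequel `…NarrowToOrbitLine.lean`), and the line's cut point is the crux hypothesis in another currency.

Helper file (`--supports stmt-ValiantsHypothesis-18332`); def-free; nothing here is a named fact; the aside
and both stubs stay open.
-/

noncomputable section

open scoped Classical

-- `Summit.ValiantsHypothesis.ValiantsHypothesis.…` is the tree's single-conjunct layout (Sub = Summit).
set_option linter.dupNamespace false

namespace Summit.ValiantsHypothesis.ValiantsHypothesis.Theorems

namespace NarrowToOrbit

open Literature.Computability.AlgebraicComplexity MvPolynomial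

universe u v

/-! ### Extending a value derivation by finitely many one-step values -/

/-- **Adjoining finitely many steps** whose operands are already values: the values of a value derivation
together with any finite set of polynomials each computed in one step (variable, constant, weighted sum,
binary product) from values again form a value derivation. [folklore] -/
theorem exists_extend {K : Type u} {X : Type v} [Field K] (𝒟 : ValueDerivation K X)
    (Q : Finset (MvPolynomial X K))
    (hQ : ∀ q ∈ Q, ∃ d : StepData K X, d.value = q ∧ ∀ u ∈ d.args, u ∈ 𝒟.S) :
    ∃ 𝒟' : ValueDerivation K X, ∀ r, r ∈ 𝒟'.S ↔ r ∈ 𝒟.S ∨ r ∈ Q := by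
  refine ⟨⟨𝒟.S ∪ Q, fun q => if q ∈ 𝒟.S then 𝒟.rank q else 𝒟.S.sup 𝒟.rank + 1, ?_⟩,
    fun r => Finset.mem_union⟩
  intro q hq
  by_cases hqS : q ∈ 𝒟.S
  · obtain ⟨d, hd⟩ := 𝒟.step q hqS
    refine ⟨d, ⟨hd.value_eq, fun u hu => ?_⟩⟩
    obtain ⟨huS, hlt⟩ := hd.args_lt u hu
    refine ⟨Finset.mem_union_left _ huS, ?_⟩
    simp only [if_pos huS, if_pos hqS]
    exact hlt
  · obtain ⟨d, hdv, hda⟩ := hQ q ((Finset.mem_union.1 hq).resolve_left hqS)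
    refine ⟨d, ⟨hdv, fun u hu => ?_⟩⟩
    have huS := hda u hu
    refine ⟨Finset.mem_union_left _ huS, ?_⟩
    simp only [if_pos huS, if_neg hqS]
    exact Nat.lt_succ_of_le (Finset.le_sup (f := 𝒟.rank) huS)

/-- The value of a weighted-sum step with all weights `1` over a `Finset`-indexed family is the sum of the
family. [folklore] -/
theorem value_sum_one {K : Type u} {X : Type v} [Field K] {ι : Type*} (s : Finset ι)
    (g : ι → MvPolynomial X K) :
    (StepData.sum (s.val.map fun i => ((1 : K), g i))).value = ∑ i ∈ s, g i := by
  simp only [StepData.value, Multiset.map_map, Function.comp_def, map_one, one_mul]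
  exact (Finset.sum_eq_multiset_sum s g).symm

/-- The operands of that weighted-sum step are the members of the family. [folklore] -/
theorem mem_args_sum_one {K : Type u} {X : Type v} [Field K] {ι : Type*} (s : Finset ι)
    (g : ι → MvPolynomial X K) {u : MvPolynomial X K}
    (hu : u ∈ (StepData.sum (s.val.map fun i => ((1 : K), g i))).args) : ∃ i ∈ s, g i = u := by
  simp only [StepData.args, Multiset.map_map, Function.comp_def, Multiset.mem_map, Finset.mem_val] at hu
  exact hu

/-! ### The values of a pattern expression are supported on their labels -/

variable {k l : ℕ} (n : ℕ)

/-- The diagonal action on a value is relabelling both assignments (`PatternExpr.rename_value` with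
`σ = τ`). [cite: DawarPagoSeppelt2025, §5] -/
theorem ren_value (σ : Equiv.Perm (Fin n)) (e : PatternExpr ℂ k l) (ρ : Fin k → Fin n)
    (γ : Fin l → Fin n) : ren σ (e.value n ρ γ) = e.value n (σ ∘ ρ) (σ ∘ γ) :=
  PatternExpr.rename_value n σ σ e ρ γ

/-- **Values are supported on their labels**: a permutation fixing the labels `ρ(Fin k) ∪ γ(Fin l)`
pointwise fixes `value n e ρ γ`. [folklore] -/
theorem ren_value_of_fix (σ : Equiv.Perm (Fin n)) (e : PatternExpr ℂ k l) (ρ : Fin k → Fin n)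
    (γ : Fin l → Fin n) (hσ : ∀ i ∈ Finset.univ.image ρ ∪ Finset.univ.image γ, σ i = i) :
    ren σ (e.value n ρ γ) = e.value n ρ γ := by
  rw [ren_value]
  have hρ : σ ∘ ρ = ρ := funext fun a =>
    hσ _ (Finset.mem_union_left _ (Finset.mem_image_of_mem ρ (Finset.mem_univ a)))
  have hγ : σ ∘ γ = γ := funext fun b =>
    hσ _ (Finset.mem_union_right _ (Finset.mem_image_of_mem γ (Finset.mem_univ b)))
  rw [hρ, hγ]

/-- There are at most `k + l` labels. [folklore] -/
theorem card_labels_le (ρ : Fin k → Fin n) (γ : Fin l → Fin n) :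
    (Finset.univ.image ρ ∪ Finset.univ.image γ).card ≤ k + l :=
  (Finset.card_union_le _ _).trans (Nat.add_le_add (Finset.card_image_le.trans (by simp))
    (Finset.card_image_le.trans (by simp)))

/-- **The values of a pattern expression form a supported value derivation.**  For every labelled pattern
expression `e` with `k` row and `l` column labels there is a value derivation containing every
`value n e ρ γ`, all of whose values are fixed by the pointwise stabiliser of at most `k + l` indices.
Induction on `e`: edges and constants are one-step values (supports `{i, j}` resp. `∅`); a sum / product /
summed-out label is one weighted-sum or product step from the values of the sub-expressions.
[cite: DawarPagoSeppelt2025, §5] -/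
theorem exists_valueDerivation_value (e : PatternExpr ℂ k l) :
    ∃ 𝒟 : ValueDerivation ℂ (Fin n × Fin n),
      (∀ (ρ : Fin k → Fin n) (γ : Fin l → Fin n), e.value n ρ γ ∈ 𝒟.S) ∧
      ∀ q ∈ 𝒟.S, ∃ T : Finset (Fin n), T.card ≤ k + l ∧
        ∀ σ : Equiv.Perm (Fin n), (∀ i ∈ T, σ i = i) → ren σ q = q := by
  induction e with
  | edge a b =>
    refine ⟨⟨Finset.univ.image fun x : Fin n × Fin n => (X x : MvPolynomial (Fin n × Fin n) ℂ),
      fun _ => 0, ?_⟩, ?_, ?_⟩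
    · intro q hq
      obtain ⟨x, -, rfl⟩ := Finset.mem_image.1 hq
      exact ⟨StepData.var x, ⟨rfl, fun u hu => by simp [StepData.args] at hu⟩⟩
    · intro ρ γ
      exact Finset.mem_image.2 ⟨(ρ a, γ b), Finset.mem_univ _, rfl⟩
    · intro q hq
      obtain ⟨x, -, rfl⟩ := Finset.mem_image.1 hq
      refine ⟨{x.1, x.2}, ?_, fun σ hσ => ?_⟩
      · have hk : 1 ≤ k := Nat.one_le_of_lt a.isLt
        have hl : 1 ≤ l := Nat.one_le_of_lt b.isLt
        exact Finset.card_le_two.trans (by omega)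
      · rw [ren_X]
        have h1 : σ x.1 = x.1 := hσ _ (by simp)
        have h2 : σ x.2 = x.2 := hσ _ (by simp)
        change X (σ x.1, σ x.2) = X x
        rw [h1, h2]
  | const c =>
    refine ⟨⟨{(C c : MvPolynomial (Fin n × Fin n) ℂ)}, fun _ => 0, ?_⟩, ?_, ?_⟩
    · intro q hq
      rw [Finset.mem_singleton] at hq
      subst hq
      exact ⟨StepData.const c, ⟨rfl, fun u hu => by simp [StepData.args] at hu⟩⟩
    · intro ρ γ
      exact Finset.mem_singleton.2 rfl
    · intro q hq
      rw [Finset.mem_singleton] at hq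
      subst hq
      exact ⟨∅, by simp, fun σ _ => ren_C σ c⟩
  | add e₁ e₂ ih₁ ih₂ =>
    obtain ⟨𝒟₁, hv₁, hs₁⟩ := ih₁
    obtain ⟨𝒟₂, hv₂, hs₂⟩ := ih₂
    obtain ⟨𝒟, h𝒟⟩ := exists_extend (𝒟₁.union 𝒟₂)
      (Finset.univ.image fun ργ : (Fin k → Fin n) × (Fin l → Fin n) =>
        (PatternExpr.add e₁ e₂).value n ργ.1 ργ.2) (by
      intro q hq
      obtain ⟨⟨ρ, γ⟩, -, rfl⟩ := Finset.mem_image.1 hq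
      refine ⟨StepData.sum ((Finset.univ : Finset Bool).val.map fun i =>
        ((1 : ℂ), if i then e₁.value n ρ γ else e₂.value n ρ γ)), ?_, fun u hu => ?_⟩
      · rw [value_sum_one]
        simp
      · obtain ⟨i, -, rfl⟩ := mem_args_sum_one _ _ hu
        cases i
        · exact ValueDerivation.mem_union_S_right (hv₂ ρ γ)
        · exact ValueDerivation.mem_union_S_left (hv₁ ρ γ))
    refine ⟨𝒟, fun ρ γ => (h𝒟 _).2 (Or.inr (Finset.mem_image.2 ⟨(ρ, γ), Finset.mem_univ _, rfl⟩)),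
      fun q hq => ?_⟩
    rcases (h𝒟 q).1 hq with hq | hq
    · rcases ValueDerivation.mem_union_S.1 hq with hq | hq
      · exact hs₁ q hq
      · exact hs₂ q hq
    · obtain ⟨⟨ρ, γ⟩, -, rfl⟩ := Finset.mem_image.1 hq
      exact ⟨_, card_labels_le n ρ γ, fun σ hσ => ren_value_of_fix n σ _ ρ γ hσ⟩
  | mul e₁ e₂ ih₁ ih₂ =>
    obtain ⟨𝒟₁, hv₁, hs₁⟩ := ih₁
    obtain ⟨𝒟₂, hv₂, hs₂⟩ := ih₂
    obtain ⟨𝒟, h𝒟⟩ := exists_extend (𝒟₁.union 𝒟₂)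
      (Finset.univ.image fun ργ : (Fin k → Fin n) × (Fin l → Fin n) =>
        (PatternExpr.mul e₁ e₂).value n ργ.1 ργ.2) (by
      intro q hq
      obtain ⟨⟨ρ, γ⟩, -, rfl⟩ := Finset.mem_image.1 hq
      refine ⟨StepData.prod (e₁.value n ρ γ) (e₂.value n ρ γ), rfl, fun u hu => ?_⟩
      simp only [StepData.args, Multiset.insert_eq_cons, Multiset.mem_cons, Multiset.mem_singleton] at hu
      rcases hu with rfl | rfl
      · exact ValueDerivation.mem_union_S_left (hv₁ ρ γ)
      · exact ValueDerivation.mem_union_S_right (hv₂ ρ γ))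
    refine ⟨𝒟, fun ρ γ => (h𝒟 _).2 (Or.inr (Finset.mem_image.2 ⟨(ρ, γ), Finset.mem_univ _, rfl⟩)),
      fun q hq => ?_⟩
    rcases (h𝒟 q).1 hq with hq | hq
    · rcases ValueDerivation.mem_union_S.1 hq with hq | hq
      · exact hs₁ q hq
      · exact hs₂ q hq
    · obtain ⟨⟨ρ, γ⟩, -, rfl⟩ := Finset.mem_image.1 hq
      exact ⟨_, card_labels_le n ρ γ, fun σ hσ => ren_value_of_fix n σ _ ρ γ hσ⟩
  | sumRow a e ih =>
    obtain ⟨𝒟₁, hv₁, hs₁⟩ := ih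
    obtain ⟨𝒟, h𝒟⟩ := exists_extend 𝒟₁
      (Finset.univ.image fun ργ : (Fin k → Fin n) × (Fin l → Fin n) =>
        (PatternExpr.sumRow a e).value n ργ.1 ργ.2) (by
      intro q hq
      obtain ⟨⟨ρ, γ⟩, -, rfl⟩ := Finset.mem_image.1 hq
      refine ⟨StepData.sum ((Finset.univ : Finset (Fin n)).val.map fun v =>
        ((1 : ℂ), e.value n (Function.update ρ a v) γ)), ?_, fun u hu => ?_⟩
      · rw [value_sum_one]
        rfl
      · obtain ⟨v, -, rfl⟩ := mem_args_sum_one _ _ hu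
        exact hv₁ _ _)
    refine ⟨𝒟, fun ρ γ => (h𝒟 _).2 (Or.inr (Finset.mem_image.2 ⟨(ρ, γ), Finset.mem_univ _, rfl⟩)),
      fun q hq => ?_⟩
    rcases (h𝒟 q).1 hq with hq | hq
    · exact hs₁ q hq
    · obtain ⟨⟨ρ, γ⟩, -, rfl⟩ := Finset.mem_image.1 hq
      exact ⟨_, card_labels_le n ρ γ, fun σ hσ => ren_value_of_fix n σ _ ρ γ hσ⟩
  | sumCol b e ih =>
    obtain ⟨𝒟₁, hv₁, hs₁⟩ := ih
    obtain ⟨𝒟, h𝒟⟩ := exists_extend 𝒟₁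
      (Finset.univ.image fun ργ : (Fin k → Fin n) × (Fin l → Fin n) =>
        (PatternExpr.sumCol b e).value n ργ.1 ργ.2) (by
      intro q hq
      obtain ⟨⟨ρ, γ⟩, -, rfl⟩ := Finset.mem_image.1 hq
      refine ⟨StepData.sum ((Finset.univ : Finset (Fin n)).val.map fun v =>
        ((1 : ℂ), e.value n ρ (Function.update γ b v))), ?_, fun u hu => ?_⟩
      · rw [value_sum_one]
        rfl
      · obtain ⟨v, -, rfl⟩ := mem_args_sum_one _ _ hu
        exact hv₁ _ _)
    refine ⟨𝒟, fun ρ γ => (h𝒟 _).2 (Or.inr (Finset.mem_image.2 ⟨(ρ, γ), Finset.mem_univ _, rfl⟩)),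
      fun q hq => ?_⟩
    rcases (h𝒟 q).1 hq with hq | hq
    · exact hs₁ q hq
    · obtain ⟨⟨ρ, γ⟩, -, rfl⟩ := Finset.mem_image.1 hq
      exact ⟨_, card_labels_le n ρ γ, fun σ hσ => ren_value_of_fix n σ _ ρ γ hσ⟩

/-- **The closed polynomial of a pattern expression has a supported value derivation** (one more
weighted-sum step over all label assignments; the closed polynomial itself is diagonally invariant,
support `∅`). [cite: DawarPagoSeppelt2025, §5] -/
theorem exists_valueDerivation_close (e : PatternExpr ℂ k l) :
    ∃ 𝒟 : ValueDerivation ℂ (Fin n × Fin n), e.close n ∈ 𝒟.S ∧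
      ∀ q ∈ 𝒟.S, ∃ T : Finset (Fin n), T.card ≤ k + l ∧
        ∀ σ : Equiv.Perm (Fin n), (∀ i ∈ T, σ i = i) → ren σ q = q := by
  obtain ⟨𝒟₁, hv, hs⟩ := exists_valueDerivation_value n e
  obtain ⟨𝒟, h𝒟⟩ := exists_extend 𝒟₁ {e.close n} (by
    intro q hq
    rw [Finset.mem_singleton] at hq
    subst hq
    refine ⟨StepData.sum ((Finset.univ : Finset ((Fin k → Fin n) × (Fin l → Fin n))).val.map
      fun ργ => ((1 : ℂ), e.value n ργ.1 ργ.2)), ?_, fun u hu => ?_⟩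
    · rw [value_sum_one, PatternExpr.close, ← Finset.univ_product_univ, Finset.sum_product]
    · obtain ⟨ργ, -, rfl⟩ := mem_args_sum_one _ _ hu
      exact hv _ _)
  refine ⟨𝒟, (h𝒟 _).2 (Or.inr (Finset.mem_singleton.2 rfl)), fun q hq => ?_⟩
  rcases (h𝒟 q).1 hq with hq | hq
  · exact hs q hq
  · rw [Finset.mem_singleton] at hq
    subst hq
    exact ⟨∅, by simp, fun σ _ => PatternExpr.rename_perm_close n σ σ e⟩

/-- **A closed pattern expression with `k + l` labels — of ANY length — has a square-symmetric circuit of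
orbit size `≤ (n+1)^{2(k+l)+4}`** (value-orbit symmetrisation through rigid supports,
`ValueOrbit.qpOrbit_of_supportedDerivation`; the circuit is the reduced term circuit of the values, whose
Dawar–Wilsenach orbits are its designed orbits). [cite: DawarPagoSeppelt2025, §5 (proof of Thm 5.3)] -/
theorem exists_symmetric_orbit_le_of_close (e : PatternExpr ℂ k l) :
    ∃ (G : Type) (_ : Fintype G) (C : LabelledArithCircuit ℂ (Fin n × Fin n) Unit G),
      C.IsSymmetric (Equiv.Perm (Fin n)) ∧ C.eval (C.output ()) = e.close n ∧
        C.orbitSize (Equiv.Perm (Fin n)) ≤ (n + 1) ^ (2 * (k + l) + 4) := by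
  obtain ⟨𝒟, hf, hs⟩ := exists_valueDerivation_close n e
  exact ValueOrbit.qpOrbit_of_supportedDerivation 𝒟 hf (fun σ => PatternExpr.rename_perm_close n σ σ e) hs

/-- At `n = 1` every value is invariant, so the orbit size is `≤ 16`. [folklore] -/
theorem exists_symmetric_orbit_le_of_close_one (e : PatternExpr ℂ k l) :
    ∃ (G : Type) (_ : Fintype G) (C : LabelledArithCircuit ℂ (Fin 1 × Fin 1) Unit G),
      C.IsSymmetric (Equiv.Perm (Fin 1)) ∧ C.eval (C.output ()) = e.close 1 ∧
        C.orbitSize (Equiv.Perm (Fin 1)) ≤ 16 := by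
  obtain ⟨𝒟, hf, -⟩ := exists_valueDerivation_close 1 e
  obtain ⟨G, inst, C, hC, hev, horb⟩ := ValueOrbit.qpOrbit_of_supportedDerivation (k := 0) 𝒟 hf
    (fun σ => PatternExpr.rename_perm_close 1 σ σ e)
    (fun q _ => ⟨∅, le_rfl, fun σ _ => by rw [Subsingleton.elim σ 1, ren_one]⟩)
  exact ⟨G, inst, C, hC, hev, horb.trans (by norm_num)⟩

/-! ### Quasi-polynomial bookkeeping -/

/-- Arithmetic: for `2 ≤ n` and `n^m ≤ 2^{(log₂ n + c)^c}`,
`(n+1)^{2m+4} ≤ 2^{(log₂ n + c + 4)^{c+4}}`. [folklore] -/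
theorem orbit_arith {n m c : ℕ} (hn : 2 ≤ n) (hm : n ^ m ≤ 2 ^ ((Nat.log 2 n + c) ^ c)) :
    (n + 1) ^ (2 * m + 4) ≤ 2 ^ ((Nat.log 2 n + (c + 4)) ^ (c + 4)) := by
  have hlt : n < 2 ^ (Nat.log 2 n + 1) := Nat.lt_pow_succ_log_self Nat.one_lt_two n
  generalize Nat.log 2 n = L at hm hlt ⊢
  set A := (L + c) ^ c with hA
  have hA1 : 1 ≤ A := by
    rcases Nat.eq_zero_or_pos c with rfl | hc
    · simp [hA]
    · exact Nat.one_le_pow _ _ (by omega)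
  -- the exponent estimate
  have hX : 8 * L + 12 ≤ (L + (c + 4)) ^ 4 := by
    have h3 : 64 ≤ (L + (c + 4)) ^ 3 :=
      le_trans (by norm_num) (Nat.pow_le_pow_left (show 4 ≤ L + (c + 4) by omega) 3)
    have h4 : (L + (c + 4)) ^ 4 = (L + (c + 4)) ^ 3 * (L + (c + 4)) := pow_succ _ 3
    rw [h4]
    calc 8 * L + 12 ≤ 64 * (L + (c + 4)) := by omega
      _ ≤ (L + (c + 4)) ^ 3 * (L + (c + 4)) := Nat.mul_le_mul_right _ h3
  have hAX : 4 * A + 8 * L + 8 ≤ A * (L + (c + 4)) ^ 4 := by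
    have h1 := Nat.mul_le_mul_left A hX
    nlinarith [h1, hA1]
  have hexp : 4 * A + 8 * L + 8 ≤ (L + (c + 4)) ^ (c + 4) := by
    refine hAX.trans ?_
    rw [pow_add]
    exact Nat.mul_le_mul_right _ (Nat.pow_le_pow_left (by omega) c)
  -- the base estimate
  have hn1 : n + 1 ≤ n * n := by nlinarith
  calc (n + 1) ^ (2 * m + 4) ≤ (n * n) ^ (2 * m + 4) := Nat.pow_le_pow_left hn1 _
    _ = (n ^ m) ^ 4 * n ^ 8 := by rw [← pow_two, ← pow_mul, ← pow_mul, ← pow_add]; ring_nf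
    _ ≤ (2 ^ A) ^ 4 * (2 ^ (L + 1)) ^ 8 :=
        Nat.mul_le_mul (Nat.pow_le_pow_left hm 4) (Nat.pow_le_pow_left hlt.le 8)
    _ = 2 ^ (4 * A + 8 * L + 8) := by rw [← pow_mul, ← pow_mul, ← pow_add]; ring_nf
    _ ≤ 2 ^ ((L + (c + 4)) ^ (c + 4)) := Nat.pow_le_pow_right (by norm_num) hexp

/-! ### The converse of Stub 1 -/

/-- **NARROW EXPRESSIONS HAVE QUASI-POLYNOMIAL ORBITS — the conclusion of `stub_orbitToNarrowExpression`
implies its hypothesis.**  If `f n` is, for every `n ≥ 1`, the closed polynomial of a labelled pattern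
expression with `k_n + l_n` labels, `n^{k_n+l_n} ≤ 2^{(log₂ n + c)^c}`, of ANY length, then `f` has
square-symmetric circuits of quasi-polynomial ORBIT size (constant `c + 4`).  No `VP` hypothesis, no
matrix symmetry assumed (it follows: closed expressions are matrix-symmetric). [cite: DawarPagoSeppelt2025, §5] -/
theorem qpOrbit_of_narrowExpression (f : (n : ℕ) → MvPolynomial (Fin n × Fin n) ℂ)
    (h : ∃ c : ℕ, ∀ n : ℕ, 1 ≤ n → ∃ (k l : ℕ) (e : PatternExpr ℂ k l),
      n ^ (k + l) ≤ 2 ^ ((Nat.log 2 n + c) ^ c) ∧ e.close n = f n) :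
    ∃ c : ℕ, ∀ n : ℕ, ∃ (G : Type) (_ : Fintype G)
      (C : LabelledArithCircuit ℂ (Fin n × Fin n) Unit G),
      C.IsSymmetric (Equiv.Perm (Fin n)) ∧ C.eval (C.output ()) = f n ∧
      C.orbitSize (Equiv.Perm (Fin n)) ≤ 2 ^ ((Nat.log 2 n + (c + 4)) ^ (c + 4)) := by
  obtain ⟨c, hc⟩ := h
  refine ⟨c, fun n => ?_⟩
  rcases Nat.lt_or_ge n 2 with hn | hn
  · interval_cases n
    · -- `n = 0`: no variables, `f 0` is a constant
      obtain ⟨G, inst, C, hC, hev, hcard⟩ := zeta_symmetric_constant (X := Fin 0 × Fin 0)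
        (Γ := Equiv.Perm (Fin 0)) (MvPolynomial.coeff 0 (f 0))
      refine ⟨G, inst, C, hC, ?_, ((C.orbitSize_le_size _).trans hcard).trans Nat.one_le_two_pow⟩
      rw [hev]
      exact (MvPolynomial.eq_C_of_isEmpty (f 0)).symm
    · -- `n = 1`: the symmetry group is trivial
      obtain ⟨k, l, e, -, he⟩ := hc 1 le_rfl
      obtain ⟨G, inst, C, hC, hev, horb⟩ := exists_symmetric_orbit_le_of_close_one e
      refine ⟨G, inst, C, hC, hev.trans he, horb.trans ?_⟩
      have h4 : 4 ≤ (Nat.log 2 1 + (c + 4)) ^ (c + 4) :=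
        le_trans (by simp) (Nat.le_self_pow (by omega) (Nat.log 2 1 + (c + 4)))
      exact le_trans (by norm_num) (Nat.pow_le_pow_right (by norm_num) h4)
  · obtain ⟨k, l, e, hkl, he⟩ := hc n (by omega)
    obtain ⟨G, inst, C, hC, hev, horb⟩ := exists_symmetric_orbit_le_of_close n e
    exact ⟨G, inst, C, hC, hev.trans he, horb.trans (orbit_arith hn hkl)⟩

/-- The same with the constant repackaged as in the route's statements. [folklore] -/
theorem qpOrbit_of_narrowExpression' (f : (n : ℕ) → MvPolynomial (Fin n × Fin n) ℂ)
    (h : ∃ c : ℕ, ∀ n : ℕ, 1 ≤ n → ∃ (k l : ℕ) (e : PatternExpr ℂ k l),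
      n ^ (k + l) ≤ 2 ^ ((Nat.log 2 n + c) ^ c) ∧ e.close n = f n) :
    ∃ c : ℕ, ∀ n : ℕ, ∃ (G : Type) (_ : Fintype G)
      (C : LabelledArithCircuit ℂ (Fin n × Fin n) Unit G),
      C.IsSymmetric (Equiv.Perm (Fin n)) ∧ C.eval (C.output ()) = f n ∧
      C.orbitSize (Equiv.Perm (Fin n)) ≤ 2 ^ ((Nat.log 2 n + c) ^ c) := by
  obtain ⟨c, hc⟩ := qpOrbit_of_narrowExpression f h
  exact ⟨c + 4, hc⟩

end NarrowToOrbit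

end Summit.ValiantsHypothesis.ValiantsHypothesis.Theorems

end
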